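import Literature.Geometry.Lorentzian.PenroseSingularityTheorem
import Literature.Geometry.Lorentzian.FutureTrappedSet
import Literature.Geometry.Lorentzian.FutureNullCompleteness
import Literature.Geometry.Riemannian.NormalExponentialMap
import Literature.Geometry.Riemannian.MaximalGeodesicRescaling
import HarnessLib

/-!
# The Penrose singularity theorem: reduction to the structure of the horismos of the trapped
# surface

Towards `theorem Penrose1965_singularityTheorem_holds : Penrose1965_singularityTheorem`
(`Literature.Geometry.Lorentzian.PenroseSingularityTheorem`; Penrose 1965; Hawking–Ellis 1973,
§8.2, Theorem 1, pp. 263–264; O'Neill 1983, Ch. 14, Prop. 60, Theorem 61 and Corollary A,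
pp. 435–437). The printed proof has two halves:

1. (**causal / topological**) if `M` is globally hyperbolic with a NON-COMPACT Cauchy
   hypersurface, then for a nonempty compact `K` the future horismos `E⁺(K) = J⁺(K) ∖ I⁺(K)`
   lies in no compact set — Hawking–Ellis: "there is clearly going to be trouble if one demands
   that `ℋ` is non-compact"; O'Neill: Theorem 61 with Corollary A. This half is PROVED in the
   tree (`IsGloballyHyperbolic.not_subset_compact_causalFuture_diff`,
   `Literature.Geometry.Lorentzian.FutureTrappedSet`, through the flow-based endgame of
   `Literature.Geometry.Lorentzian.NoncompactCauchyFutureSet` and the closedness of `J⁺(K)`,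
   `Literature.Geometry.Lorentzian.CausalFutureCompactSet`).
2. (**geodesic**) under the null convergence condition, if the future-directed null geodesics
   normal to the closed trapped surface `𝒯 = f(T)` are future complete, then every point of
   `E⁺(𝒯) ∖ 𝒯` lies on one of them at affine distance at most `b₀ = 2/c₀` from `𝒯`, `-c₀ < 0`
   the maximum of the null expansions — Hawking–Ellis: "`𝛽(𝒯 × [0, b₀] × Q)` would contain
   `J̇⁺(𝒯)`", by Props. 4.4.6 (focusing), 4.5.14 (beyond a focal point the geodesic enters
   `I⁺(𝒯)`) and the generator structure of `J̇⁺(𝒯) = E⁺(𝒯)` (Prop. 6.6.1 ff.); O'Neill: Prop. 60,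
   by Prop. 10.43, Prop. 10.48 and Theorem 10.51.

This file proves the ASSEMBLY of the two halves (`Penrose1965_singularityTheorem_of_horismos`):
the theorem follows from half 2 stated as an explicit hypothesis on the horismos of trapped
surfaces (`horismosGenerated`, written out — not a named fact), because the light sheets
`𝛽(T × [0, b₀])` swept out by the two families of null normal geodesics are compact
(`isCompact_image_normalExp_prod_Icc`: continuity of `(y, t) ↦ exp_{f y}(t L(y))` on the domain
of the normal exponential map, `Literature.Geometry.Riemannian.contMDiffOn_normalExp`), the null
normal geodesics are future complete as soon as the spacetime is not future null geodesically
incomplete (`Ici_subset_maximalGeodesicDomain_of_not_isFutureNullGeodesicallyIncomplete`,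
`Literature.Geometry.Lorentzian.FutureNullCompleteness`), and half 1 then yields the
contradiction. Half 2 itself (the null focal-point theory of O'Neill 1983, Ch. 10, for a
spacelike submanifold of codimension two) is the remaining work of this programme.

No definitions and no named facts are introduced.

## References

* R. Penrose, *Gravitational collapse and space-time singularities*, Phys. Rev. Lett. 14 (1965),
  57–59.
* S. W. Hawking, G. F. R. Ellis, *The large scale structure of space-time*, CUP 1973, §8.2,
  Theorem 1 (pp. 263–264); §4.4, Prop. 4.4.6; §4.5, Prop. 4.5.14; §6.6, Prop. 6.6.1.
* B. O'Neill, *Semi-Riemannian geometry with applications to relativity*, Academic Press 1983,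
  Ch. 10, Prop. 43, Prop. 48, Theorem 51 (pp. 291–297); Ch. 14, Prop. 60, Theorem 61,
  Corollary A (pp. 435–437).
* R. M. Wald, *General Relativity*, Chicago 1984, Theorem 9.5.3 (p. 240).
-/

noncomputable section

open Bundle Set Filter Function
open scoped Manifold ContDiff Topology

namespace Literature.Geometry.Lorentzian

open Literature.Geometry.Riemannian

universe u

/-! ### Compactness of light sheets over a compact surface -/

section LightSheet

variable {E : Type*} [NormedAddCommGroup E] [NormedSpace ℝ E] {H : Type*} [TopologicalSpace H]
  {I : ModelWithCorners ℝ E H} {M : Type*} [TopologicalSpace M] [ChartedSpace H M]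
  [IsManifold I ∞ M] [FiniteDimensional ℝ E] [CompleteSpace E] [T2Space M]
  [BoundarylessManifold I M]
  {E' : Type*} [NormedAddCommGroup E'] [NormedSpace ℝ E'] {H' : Type*} [TopologicalSpace H']
  {I' : ModelWithCorners ℝ E' H'} {N : Type*} [TopologicalSpace N] [ChartedSpace H' N]
  {cov : CovariantDerivative I E (TangentSpace I : M → Type _)}
  [CovariantDerivative.ContMDiffCovariantDerivative cov 1]
  {ι : N → M} {ν : Π z : N, TangentSpace I (ι z)}

/-- **The light sheet swept out over a compact set of parameters is compact.** For a `C¹`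
connection on a Hausdorff manifold without boundary and a `C¹` field `ν` along `ι : N → M`
(`z ↦ (ι z, ν z) ∈ TM` of class `C¹`) whose normal geodesics `γ_{(ι z, ν z)}` are all defined on
`[0, b]`, the image of `K × [0, b]`, `K ⊆ N` compact, under `(z, t) ↦ γ_{(ι z, ν z)}(t)` — the set
`𝛽(𝒯 × [0, b])` of Hawking–Ellis 1973, §8.2, p. 263 — is compact: it is the continuous image
(`contMDiffOn_normalExp`: `(z, t) ↦ exp_{ι z}(t ν z)` is `C¹` on the open domain of the normal
exponential map, and `exp_{ι z}(t ν z) = γ_{(ι z, ν z)}(t)` there, `expMap_smul_of_mem`) of a compact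
set. [cite: HawkingEllis1973CUP, §8.2, Theorem 1 (proof, p. 263)] -/
theorem isCompact_image_normalGeodesic_prod_Icc
    (hν : ContMDiff I' I.tangent 1 (fun z ↦ (TotalSpace.mk' E (ι z) (ν z) : TangentBundle I M)))
    {K : Set N} (hK : IsCompact K) {b : ℝ}
    (hdom : ∀ z ∈ K, Icc (0 : ℝ) b ⊆ maximalGeodesicDomain cov (ι z) (ν z)) :
    IsCompact ((fun q : N × ℝ ↦ maximalGeodesic cov (ι q.1) (ν q.1) q.2) '' (K ×ˢ Icc (0 : ℝ) b)) := by
  have hsub : K ×ˢ Icc (0 : ℝ) b ⊆ {q : N × ℝ | q.2 ∈ maximalGeodesicDomain cov (ι q.1) (ν q.1)} :=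
    fun q hq ↦ hdom q.1 hq.1 hq.2
  have hcont : ContinuousOn (fun q : N × ℝ ↦ expMap cov (ι q.1) (q.2 • ν q.1)) (K ×ˢ Icc (0 : ℝ) b) :=
    ((contMDiffOn_normalExp (cov := cov) (k := 1) le_rfl hν).continuousOn).mono hsub
  have heq : EqOn (fun q : N × ℝ ↦ maximalGeodesic cov (ι q.1) (ν q.1) q.2)
      (fun q : N × ℝ ↦ expMap cov (ι q.1) (q.2 • ν q.1)) (K ×ˢ Icc (0 : ℝ) b) := fun q hq ↦
    ((expMap_smul_of_mem (cov := cov) (ι q.1) (ν q.1) (hsub hq)).2).symm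
  rw [image_congr heq]
  exact (hK.prod isCompact_Icc).image_of_continuousOn hcont

end LightSheet

/-! ### The assembly -/

/-- **The Penrose singularity theorem, assembled from the structure of the horismos of the
trapped surface.** Hypothesis `horismosGenerated` (half 2 of the printed proof, Hawking–Ellis
1973, §8.2, p. 263: under the null convergence condition, if the future null normal geodesics
`γ_{L(y)}`, `γ_{L̲(y)}` of a closed trapped surface `f : T → M` — both null expansions negative —
are defined on `[0, ∞)`, then there is `b₀` such that every point of
`E⁺(f(T)) = J⁺(f(T)) ∖ I⁺(f(T))` off `f(T)` is `γ_{L(y)}(t)` or `γ_{L̲(y)}(t)` for some `y` and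
some `t ∈ [0, b₀]`; there `b₀ = 2/c₀`, by Props. 4.4.6, 4.5.14 and 6.6.1; O'Neill 1983, Ch. 14,
Prop. 60 via Ch. 10, Props. 43, 48 and Thm. 51). Conclusion: `Penrose1965_singularityTheorem`.
Proof: were the spacetime not future null geodesically incomplete, the null normal geodesics
would be defined on `[0, ∞)`
(`Ici_subset_maximalGeodesicDomain_of_not_isFutureNullGeodesicallyIncomplete`), the light sheets
`𝛽(T × [0, b₀])` would be compact (`isCompact_image_normalGeodesic_prod_Icc`), so `E⁺(f(T))` would
lie in the compact set `f(T) ∪ 𝛽_L ∪ 𝛽_L̲`, which the non-compact Cauchy hypersurface forbids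
(`IsGloballyHyperbolic.not_subset_compact_causalFuture_diff`; Hawking–Ellis, p. 264; O'Neill,
Thm. 61, Cor. A). [cite: HawkingEllis1973CUP, §8.2, Theorem 1 (pp. 263–264)] -/
theorem Penrose1965_singularityTheorem_of_horismos
    (horismosGenerated : ∀ (𝓢 : Spacetime.{u} 4) [𝓢.metric.HasLeviCivita],
      𝓢.metric.SatisfiesNullConvergence →
      ∀ {T : Type} [TopologicalSpace T] [ChartedSpace (EuclideanSpace ℝ (Fin 2)) T]
        [IsManifold (𝓡 2) ∞ T] [CompactSpace T] [T2Space T] [Nonempty T] (f : T → 𝓢.carrier)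
        (hpb : PseudoRiemannianMetric.contMDiff_pullbackBilin (𝓡 4) 𝓢.carrier (𝓡 2) T ∞)
        (hf : 𝓢.metric.IsSpacelikeImmersion (𝓡 2) f)
        (P : LorentzianMetric.NullNormalPair (𝓡 2) 𝓢.metric 𝓢.timeOrientation f),
        (∀ y : T, 𝓢.metric.nullExpansion f hpb hf P.L y < 0 ∧
          𝓢.metric.nullExpansion f hpb hf P.Lbar y < 0) →
        (∀ y : T, Ici (0 : ℝ) ⊆ maximalGeodesicDomain 𝓢.metric.leviCivita (f y) (P.L y) ∧
          Ici (0 : ℝ) ⊆ maximalGeodesicDomain 𝓢.metric.leviCivita (f y) (P.Lbar y)) →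
        ∃ b₀ : ℝ, ∀ q ∈ 𝓢.metric.causalFuture 𝓢.timeOrientation (range f) \
            𝓢.metric.chronologicalFuture 𝓢.timeOrientation (range f),
          q ∈ range f ∨ ∃ y : T, ∃ t ∈ Icc (0 : ℝ) b₀,
            q = maximalGeodesic 𝓢.metric.leviCivita (f y) (P.L y) t ∨
              q = maximalGeodesic 𝓢.metric.leviCivita (f y) (P.Lbar y) t) :
    Penrose1965_singularityTheorem.{u} := by
  intro 𝓢 _ hG S hS hSc hncc T _ _ _ _ _ _ f hf
  by_contra hinc
  -- regularity instances of the smooth spacetime metric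
  haveI : CovariantDerivative.ContMDiffCovariantDerivative 𝓢.metric.leviCivita 1 :=
    ⟨𝓢.metric.isLocallyContMDiff_leviCivita_holds 1 (by exact_mod_cast le_top) univ isOpen_univ⟩
  have h2 : (2 : ℕ∞ω) ≤ ∞ := WithTop.coe_le_coe.mpr le_top
  -- unpack the trapped surface and fix a null normal pair
  obtain ⟨_, _, hpb, hsp, ⟨P⟩, hθ⟩ := hf
  -- the null normal geodesics are future complete
  have hdom : ∀ y : T,
      Ici (0 : ℝ) ⊆ maximalGeodesicDomain 𝓢.metric.leviCivita (f y) (P.L y) ∧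
        Ici (0 : ℝ) ⊆ maximalGeodesicDomain 𝓢.metric.leviCivita (f y) (P.Lbar y) := fun y ↦
    ⟨LorentzianMetric.Ici_subset_maximalGeodesicDomain_of_not_isFutureNullGeodesicallyIncomplete
        hinc (P.isNull_L y) (P.isFutureDirected_L y),
      LorentzianMetric.Ici_subset_maximalGeodesicDomain_of_not_isFutureNullGeodesicallyIncomplete
        hinc (P.isNull_Lbar y) (P.isFutureDirected_Lbar y)⟩
  obtain ⟨b₀, hb₀⟩ := horismosGenerated 𝓢 hncc f hpb hsp P (hθ P) hdom
  -- the compact set `f(T) ∪ 𝛽_L(T × [0, b₀]) ∪ 𝛽_L̲(T × [0, b₀])`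
  set βL : T × ℝ → 𝓢.carrier := fun q ↦ maximalGeodesic 𝓢.metric.leviCivita (f q.1) (P.L q.1) q.2
    with hβL
  set βLbar : T × ℝ → 𝓢.carrier :=
    fun q ↦ maximalGeodesic 𝓢.metric.leviCivita (f q.1) (P.Lbar q.1) q.2 with hβLbar
  have hK : IsCompact (range f) := isCompact_range hsp.contMDiff.continuous
  have hC : IsCompact (range f ∪ βL '' (univ ×ˢ Icc (0 : ℝ) b₀) ∪ βLbar '' (univ ×ˢ Icc (0 : ℝ) b₀)) :=
    (hK.union (isCompact_image_normalGeodesic_prod_Icc P.contMDiff_L isCompact_univ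
      (fun y _ ↦ (Icc_subset_Ici_self).trans (hdom y).1))).union
      (isCompact_image_normalGeodesic_prod_Icc P.contMDiff_Lbar isCompact_univ
        (fun y _ ↦ (Icc_subset_Ici_self).trans (hdom y).2))
  have hEC : 𝓢.metric.causalFuture 𝓢.timeOrientation (range f) \
      𝓢.metric.chronologicalFuture 𝓢.timeOrientation (range f) ⊆
      range f ∪ βL '' (univ ×ˢ Icc (0 : ℝ) b₀) ∪ βLbar '' (univ ×ˢ Icc (0 : ℝ) b₀) := by
    intro q hq
    rcases hb₀ q hq with h | ⟨y, t, ht, h | h⟩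
    · exact Or.inl (Or.inl h)
    · exact Or.inl (Or.inr ⟨(y, t), ⟨mem_univ _, ht⟩, h.symm⟩)
    · exact Or.inr ⟨(y, t), ⟨mem_univ _, ht⟩, h.symm⟩
  exact hG.not_subset_compact_causalFuture_diff h2 hS hSc hK (range_nonempty f) hC hEC

end Literature.Geometry.Lorentzian

end
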